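import Literature.AlgebraicGeometry.Resolution.StrictTransformFiniteFlat
import Literature.AlgebraicGeometry.Resolution.BlowupFittingIdealFlatGeneral
import HarnessLib

/-!
# Raynaud–Gruson flattening for finite morphisms over an affine base, `U`-admissible form
# (Stacks 081R / 0811)

Topic: `Literature/AlgebraicGeometry/Resolution`. `StrictTransformFiniteFlat.lean` proves that
the strict transform of a finite `X → S` (affine, `B = Γ(X)` locally free of rank `r` off
`V(Fit_r(B))`) along any `b : S' → S` making `V(Fit_r(B))` an effective Cartier divisor is
flat. Raynaud–Gruson flattening in the form of Stacks 081R asks for a centre supported on the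
complement of a GIVEN open `U` over which `X` is flat (locally free of rank `r`): one blows up a
centre `C ⊆ K ∩ Fit_r(B)` with `V(K) = S ∖ U` (e.g. `C = K · Fit_r(B)`, Stacks 0811), and the
strict transform is taken with respect to `V(C) ⊇ S ∖ U`. This file proves the flatness of
that strict transform:

* `flat_blowupStrictTransformMap_admissible_of_isFinite_of_isAffine` — **for `f : X → S` finite
  between affine schemes, `I = Fit_r(Γ(X))`, `K` with `Kⁿ Fit_k(Γ(X)) = 0` (`k < r`; i.e. `X` is
  locally free of rank `r` over `S ∖ V(K)`), a centre `C ≤ I`, `C ≤ K`, and any `b : S' → S`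
  pulling both `V(C)` and `V(I)` back to effective Cartier divisors (e.g. the blowing up of `S`
  in `C = K · I`), the strict transform of `X` along `b` with respect to `V(C)` is flat over
  `S'`.**

Proof as in `StrictTransformFiniteFlat.lean`, on charts `V` of `S'` small enough that both
pulled-back ideals are principal, `I 𝒪 = (t₁)`, `C 𝒪 = (c)` with `c` a nonzerodivisor,
`t₁ ∣ c`, `c ∈ K 𝒪`; the algebra is `flat_strictTransform_admissible`
(`BlowupFittingIdealFlatGeneral.lean`).

## References

* M. Raynaud, L. Gruson, *Critères de platitude et de projectivité*, Invent. Math. 13 (1971),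
  Première partie, 5.2.2, 5.4.2. [RaynaudGruson1971]
* The Stacks Project, Tag 081R, Tag 0811. [StacksProject]
-/

noncomputable section

open CategoryTheory CategoryTheory.Limits AlgebraicGeometry TopologicalSpace TensorProduct

namespace Literature.AlgebraicGeometry.Resolution

universe u

open Literature.RingTheory.FittingIdeal Literature.AlgebraicGeometry.Limits

variable {X S : Scheme.{u}} [IsAffine X] [IsAffine S] (f : X ⟶ S)

/-- **Raynaud–Gruson flattening (Stacks 081R) for a finite morphism over an affine base,
`U`-admissible form.** Let `f : X → S` be a finite morphism of affine schemes, `R = Γ(S)`,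
`B = Γ(X)`, `I = Fit_r(B)`, `K ⊆ R` an ideal with `Kⁿ Fit_k(B) = 0` for `k < r` (so `X` is
locally free of rank `r` over `U = S ∖ V(K)`), and `C ⊆ K ∩ I` a centre (e.g. `C = K · I`,
supported on `S ∖ U` when `Kᵐ ⊆ I`). Then for every `b : S' → S` pulling `V(C)` and `V(I)`
back to effective Cartier divisors — e.g. the blowing up of `S` in `K · I` — the strict
transform of `X` along `b` (with respect to `V(C)`) is flat over `S'`.
[cite: RaynaudGruson1971, Première partie 5.2.2; StacksProject, Tag 081R] -/
theorem flat_blowupStrictTransformMap_admissible_of_isFinite_of_isAffine [IsFinite f] {r : ℕ}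
    {I K C : Ideal Γ(S, ⊤)}
    (hI : letI := f.appTop.hom.toAlgebra; Module.fittingIdeal Γ(S, ⊤) Γ(X, ⊤) r = I)
    (hK : letI := f.appTop.hom.toAlgebra;
      ∀ k < r, ∃ n : ℕ, K ^ n * Module.fittingIdeal Γ(S, ⊤) Γ(X, ⊤) k = ⊥)
    (hCI : C ≤ I) (hCK : C ≤ K) {S' : Scheme.{u}} (b : S' ⟶ S)
    (hbC : IsEffectiveCartier ((Scheme.IdealSheafData.ofIdealTop C).comap b))
    (hbI : IsEffectiveCartier ((Scheme.IdealSheafData.ofIdealTop I).comap b)) :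
    Flat (blowupStrictTransformMap f b (Scheme.IdealSheafData.ofIdealTop C)) := by
  letI algB : Algebra Γ(S, ⊤) Γ(X, ⊤) := f.appTop.hom.toAlgebra
  haveI : Module.Finite Γ(S, ⊤) Γ(X, ⊤) :=
    ((HasAffineProperty.iff_of_isAffine (P := @IsFinite) (f := f)).mp inferInstance).2
  -- charts of `S'` on which both `I 𝒪` and `C 𝒪` are principal, `C 𝒪 = (c)`, `c` regular
  have hchart : ∀ x : S', ∃ (V : S'.affineOpens) (t₁ c : Γ(S', V)), x ∈ (V : S'.Opens) ∧
      c ∈ nonZeroDivisors Γ(S', V) ∧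
      ((Scheme.IdealSheafData.ofIdealTop C).comap b).ideal V = Ideal.span {c} ∧
      ((Scheme.IdealSheafData.ofIdealTop I).comap b).ideal V = Ideal.span {t₁} := fun x => by
    obtain ⟨V₁, hxV₁, t₁, -, ht₁V₁⟩ := hbI x
    obtain ⟨V, hxV, hVV₁, c, hc, hcV⟩ := hbC.exists_chart_le x (V₁ : S'.Opens) hxV₁
    refine ⟨V, S'.presheaf.map (homOfLE hVV₁).op t₁, c, hxV, hc, hcV, ?_⟩
    rw [← ((Scheme.IdealSheafData.ofIdealTop I).comap b).map_ideal (U := V) (V := V₁) hVV₁,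
      ht₁V₁, Ideal.map_span, Set.image_singleton]
    rfl
  choose V t₁ c hxV hc hcV ht₁V using hchart
  let 𝒰 : S'.OpenCover := Scheme.Cover.mkOfCovers S' (fun x => ((V x : S'.Opens) : Scheme.{u}))
    (fun x => (V x : S'.Opens).ι) (fun x => ⟨x, ⟨x, hxV x⟩, rfl⟩) (fun x => inferInstance)
  refine blowupStrictTransformMap_of_openCover_target f b _ @Flat hbC 𝒰 fun x => ?_
  change (S' : Type u) at x
  show Flat (blowupStrictTransformMap f ((V x : S'.Opens).ι ≫ b) (Scheme.IdealSheafData.ofIdealTop C))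
  haveI : IsAffine ((V x : S'.Opens) : Scheme.{u}) := (V x).2
  have hTW : (⊤ : ((V x : S'.Opens) : Scheme.{u}).Opens) ≤
      (V x : S'.Opens).ι ⁻¹ᵁ (V x : S'.Opens) :=
    le_top.trans (Scheme.Opens.ι_preimage_self _).ge
  have hbij : Function.Bijective ((V x : S'.Opens).ι.appLE (V x) ⊤ hTW).hom :=
    ConcreteCategory.bijective_of_isIso _
  -- the generators on the whole chart
  have hc' : ((V x : S'.Opens).ι.appLE (V x) ⊤ hTW) (c x) ∈
      nonZeroDivisors Γ((V x : S'.Opens), ⊤) :=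
    mem_nonZeroDivisors_map_of_bijective _ hbij (hc x)
  have hideal : ∀ (J : Ideal Γ(S, ⊤)) (s : Γ(S', V x)),
      ((Scheme.IdealSheafData.ofIdealTop J).comap b).ideal (V x) = Ideal.span {s} →
      ((Scheme.IdealSheafData.ofIdealTop J).comap ((V x : S'.Opens).ι ≫ b)).ideal
        ⟨⊤, isAffineOpen_top _⟩ = Ideal.span {((V x : S'.Opens).ι.appLE (V x) ⊤ hTW) s} := by
    intro J s hs
    rw [Scheme.IdealSheafData.comap_comp, ideal_comap_eq_map_of_le (V x : S'.Opens).ι _ (V x)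
      ⟨⊤, isAffineOpen_top _⟩ hTW, hs, Ideal.map_span, Set.image_singleton]
  have hmap : ∀ J : Ideal Γ(S, ⊤), J.map ((V x : S'.Opens).ι ≫ b).appTop.hom =
      ((Scheme.IdealSheafData.ofIdealTop J).comap ((V x : S'.Opens).ι ≫ b)).ideal
        ⟨⊤, isAffineOpen_top _⟩ := by
    intro J
    have h := ideal_comap_preimage ((V x : S'.Opens).ι ≫ b) (Scheme.IdealSheafData.ofIdealTop J)
      ⟨⊤, isAffineOpen_top _⟩ (isAffineOpen_top _)
    rw [Scheme.IdealSheafData.ofIdealTop_ideal,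
      show (homOfLE (le_top : ((⟨⊤, isAffineOpen_top S⟩ : S.affineOpens) : S.Opens) ≤ ⊤)).op =
        𝟙 _ from Subsingleton.elim _ _, CategoryTheory.Functor.map_id, CommRingCat.hom_id,
      Ideal.map_id] at h
    exact h.symm
  have hCR' : C.map ((V x : S'.Opens).ι ≫ b).appTop.hom =
      Ideal.span {((V x : S'.Opens).ι.appLE (V x) ⊤ hTW) (c x)} := by
    rw [hmap, hideal C (c x) (hcV x)]
  have hIR' : I.map ((V x : S'.Opens).ι ≫ b).appTop.hom =
      Ideal.span {((V x : S'.Opens).ι.appLE (V x) ⊤ hTW) (t₁ x)} := by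
    rw [hmap, hideal I (t₁ x) (ht₁V x)]
  have hdiv : ((V x : S'.Opens).ι.appLE (V x) ⊤ hTW) (t₁ x) ∣
      ((V x : S'.Opens).ι.appLE (V x) ⊤ hTW) (c x) := by
    have hmem : ((V x : S'.Opens).ι.appLE (V x) ⊤ hTW) (c x) ∈
        I.map ((V x : S'.Opens).ι ≫ b).appTop.hom := by
      refine Ideal.map_mono hCI ?_
      rw [hCR']
      exact Ideal.mem_span_singleton_self _
    rw [hIR'] at hmem
    obtain ⟨a, ha⟩ := Ideal.mem_span_singleton'.mp hmem
    exact ⟨a, by rw [mul_comm, ha]⟩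
  have hcK : ((V x : S'.Opens).ι.appLE (V x) ⊤ hTW) (c x) ^ 1 ∈
      K.map ((V x : S'.Opens).ι ≫ b).appTop.hom := by
    rw [pow_one]
    refine Ideal.map_mono hCK ?_
    rw [hCR']
    exact Ideal.mem_span_singleton_self _
  -- the complement of the centre on the chart is `D(c)`
  have hO : ((V x : S'.Opens).ι ≫ b) ⁻¹ᵁ centreCompl (Scheme.IdealSheafData.ofIdealTop C) =
      ((V x : S'.Opens) : Scheme.{u}).basicOpen (((V x : S'.Opens).ι.appLE (V x) ⊤ hTW) (c x)) := by
    rw [preimage_centreCompl]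
    apply Opens.ext
    have h := inter_centreCompl_eq_basicOpen (⟨⊤, isAffineOpen_top _⟩ :
      ((V x : S'.Opens) : Scheme.{u}).affineOpens) _ (hideal C (c x) (hcV x))
    simpa only [Opens.coe_top, Set.univ_inter] using h
  have hEV : IsEffectiveCartier ((Scheme.IdealSheafData.ofIdealTop C).comap
      ((V x : S'.Opens).ι ≫ b)) := by
    rw [Scheme.IdealSheafData.comap_comp]
    exact hbC.comap_of_isOpenImmersion _
  -- flatness over the chart is flatness of the torsion quotient
  refine (flat_blowupStrictTransformMap_iff_ringHom_flat f ((V x : S'.Opens).ι ≫ b) _ hEV _ hO).mpr ?_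
  -- `Γ(X ×_S V) ≅ Γ(V) ⊗_R B` over `Γ(V)`
  letI algR' : Algebra Γ(S, ⊤) Γ((V x : S'.Opens), ⊤) := ((V x : S'.Opens).ι ≫ b).appTop.hom.toAlgebra
  have hpo₁ := (isPushout_appTop_of_isPullback (IsPullback.of_hasPullback f ((V x : S'.Opens).ι ≫ b))).flip
  have hpo₂ : IsPushout ((V x : S'.Opens).ι ≫ b).appTop f.appTop
      (CommRingCat.ofHom (Algebra.TensorProduct.includeLeftRingHom (R := Γ(S, ⊤))
        (A := Γ((V x : S'.Opens), ⊤)) (B := Γ(X, ⊤))))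
      (CommRingCat.ofHom (Algebra.TensorProduct.includeRight (R := Γ(S, ⊤))
        (A := Γ((V x : S'.Opens), ⊤)) (B := Γ(X, ⊤))).toRingHom) :=
    CommRingCat.isPushout_tensorProduct Γ(S, ⊤) Γ((V x : S'.Opens), ⊤) Γ(X, ⊤)
  let E := (hpo₁.isoIsPushout _ _ hpo₂).commRingCatIsoToRingEquiv
  have hE : ∀ y, E ((pullback.snd f ((V x : S'.Opens).ι ≫ b)).appTop y) =
      algebraMap Γ((V x : S'.Opens), ⊤) (Γ((V x : S'.Opens), ⊤) ⊗[Γ(S, ⊤)] Γ(X, ⊤)) y := fun y => by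
    change ((pullback.snd f ((V x : S'.Opens).ι ≫ b)).appTop ≫ (hpo₁.isoIsPushout _ _ hpo₂).hom) y = _
    rw [hpo₁.inl_isoIsPushout_hom]
    rfl
  exact ringHom_flat_quotient_powTorsion_of_module_flat _ E hE _ (hE _)
    (flat_strictTransform_admissible (R := Γ(S, ⊤)) (B := Γ(X, ⊤)) hI hK hdiv hIR' hc' hcK)

end Literature.AlgebraicGeometry.Resolution

end
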